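import Summits.QuantumFields.BalabanUV.Beta.SymSecondOrderTablesAn1
import Summits.QuantumFields.BalabanUV.Beta.MultiplierTableSlot
import Summits.QuantumFields.BalabanUV.Beta.WardLettersUnpacking

/-!
# `BalabanUV.Beta.SymWardLettersUnpacking` — THE ENTRYWISE (BOND-LEVEL) FORM OF THE LEVEL-0 hW WARD LETTERS OF THE (0.4)-SYMMETRISED ROW ROOT —
# `hBord0` ∕ `hBord0''` (border table `symVh₂SAn1 3 Lc`) and `hM₂` at `j = 0` (mixed table `symMixFFAt (ctr 4 Lc) Lc`, `M := M1Of 3 Lc (symHessFFAt (ctr 4 Lc) Lc) cΛ`)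
# of `RowD1JointEndSymReflTablesAn1S2`, ROOT `ctr 4 Lc` (β sub-cell, row D1, TABLES-SYM-LEAN S2d, INTERFACE-LEVEL twin of leaf-05's «WX4» `WardLettersUnpacking`; an1 gen 43)

HONEST FRAMING (cell charter, verbatim): «discharging BetaPertH makes Bałaban's UV stability UNCONDITIONAL — a real
constructive-QFT result; it is NOT the continuum limit and NOT the Clay problem.»  HONEST DEPENDENCY (verbatim): «continuum YM on
T⁴ ⇐ BetaPertH ∧ nine spine estimates (0/9 proved); BetaPertH ⇐ (D1) ∧ (D4) ∧ CAP+tail; G-an2-4 gates asym, D1 and NE2/3/4.»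
ABSOLUTE RULE (R-g25-7 ∕ R-D1-g30-1 (A)): the (0.4)-symmetrised averaging is the exp of the MEAN OF LOGS over the pair family
`{loop^{σ,σ′}}` with weight `((d!)²·L^d)⁻¹`; every object below is the comb module's algebra read on an1's `symPhiGAt` (S2b part 1)
instead of `PhiGAt` — STATEMENT FOR STATEMENT under the dictionary `PhiXAt ↦ symPhiXAt`, `XjetAt ↦ symXjetAt`, `MσXAt ↦ symMσXAt`,
`L^{-d}·linAvgAt ↦ (d!·L^d)⁻¹·symLinU`, `L^{-d}·hessUAt ↦ ((d!)²L^d)⁻¹·symHessUAt`, `L^{-2d}·vhUAt ↦ ((d!)²L^{2d})⁻¹·symVhUAt`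
(an3-g63 [AN3-G63-S2C] (C-ii): constants PER BCH ORDER; CONVENTION `(d!)²` un-normalised inside order-2 sym functionals).
FAMILY-INDEPENDENT chart ∕ letter ∕ `Tau`-algebra lemmas of the comb module are imported BY NAME, never re-proved.
DERIVED cell leaf: [folklore] ring algebra; the `sym*` families are [our object]s.  No statement of Bałaban's papers is typed here, no
`[cite:]` tag, no `Prop` is minted, no binder of the β-function wall (`hW`/`hR`/`D1Tel`/`D1Rep`, (D1), `BetaPertH`) is instantiated or
discharged; nothing about the VALUES of `symMixFFAt`∕`symVh₂SAt` and no (T2-B)∕(T2-M₂) letter is discharged in this file.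
NOT D1, NOT BetaPertH, NOT continuum, NOT Clay.  NOT summit progress.
Provenance: β sub-cell, TABLES-SYM-LEAN S2c option (C) (S2C-SCOPE-v1 94facb80ac685517), unit b2b-balaban-beta-an1-g43 (W-supplier AN1,
FREEZE (0): scratch for a courier; an1 files nothing), 2026-08-21; no existing file touched.

## What this module proves (sym twin of `WardLettersUnpacking` §1–§4, token for token under `vh₂SAn1 Lc ↦ symVh₂SAn1 3 Lc`, `vhSAt vh2KerAt vhKerAt mixFFAt mixKerAt
## hessFFAt hessKerAt ↦ symVhSAt symVh2KerAt symVhKerAt symMixFFAt symMixKerAt symHessFFAt symHessKerAt`, `M1At 3 Lc ρ_c ↦ M1Of 3 Lc (symHessFFAt ρ_c Lc)`, root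
## `toSite (ctrOff 4 Lc) ↦ ctr 4 Lc`; BOTH sides of every implication are hypothesis SHAPES)
* §0 `symVhSAt_inl_inr'`, `symVh₂SAn1_inl_inr`: the field–multiplier entries of the sym border tables (sym twins of `BorderLetterPacking` §1).
* §1 `legSum_inl/_inr` at root `ctr 4 Lc` (the block-summed divergence entry `divV_sum_apply` is the comb module `WardLettersUnpacking`'s, OPENED).
* §2 **`hBord0_of_bondWard`** ∕ §3 **`hBord0''_of_bondWard`**: the level-0 border Ward letters of the sym row root (any `cB`, remainder `0`) FROM the bond-level
  identity `hW` — the hypothesis `hW` is EXACTLY the conclusion of an1's `SymBorderWardSiteLaw.symBondWardB` (lockB `cB = −Lc¹²∕4`, `Lc` odd).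
* §4 **`hM₂0_of_bondWard`**: the level-0 mixed Ward letter with a field–field supported residual `RW₀` FROM the field–field scalar identity.
-/

open Finset
open scoped BigOperators
open Literature.MathematicalPhysics.QuantumFieldTheory
open Literature.MathematicalPhysics.QuantumFieldTheory.Balaban1983to89
open Literature.MathematicalPhysics.QuantumFieldTheory.Balaban1983to89.Beta
open ExpKernelCalculus (MKer comp)
open KernelWard (divV)
open AffineAveraging (box toSite)
open AveragingContours (blk off)
open AveragingContoursRooted (ctr ctrOff)
open AveragingHessianKernels (Bond packVH packVH_inl_inr packVH_inr_inl packVH_inl_inl packVH_inr_inr)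
open Summit.QuantumFields.BalabanUV.Beta.SymAveragingHessianCounts (symVhKerAt symLinKerAt symHessKerAt symVhSAt symVhSAt_symm symHessFFAt symHessFFAt_inl_inl
  symHessFFAt_inl_inr symHessFFAt_inr)
open Summit.QuantumFields.BalabanUV.Beta.SymAveragingMixedJetTables (symVh2KerAt symVh₂SAt symMixKerAt symMixFFAt symMixFFAt_inl_inl symMixFFAt_inl_inr symMixFFAt_inr)
open BalabanStepJetsSucc (wVH)
open BalabanStepW2 (M2Of wM1 wM2)
open Summit.QuantumFields.BalabanUV.Beta.SpineRooted (M1Of)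
open OneStepResolventKernel (Fib)
open B6BondElimination (unitVec)
open Summit.QuantumFields.BalabanUV.Beta.TameKernelCalculus
open Summit.QuantumFields.BalabanUV.Beta.BorderedHessian (diagK stepScale comp_diagK_left comp_diagK_right)
open Summit.QuantumFields.BalabanUV.Beta.AveragingWardRootedStencils (legInd legInd_inl legInd_inr)
open Summit.QuantumFields.BalabanUV.Beta.SymSecondOrderTablesAn1 (symVh₂SAn1 symVh₂SAn1_inl_inl symVh₂SAn1_inr_inr symVh₂SAn1_antiTwin symVh₂SAn1_swap)
open Summit.QuantumFields.BalabanUV.Beta.WardLettersUnpacking (divV_sum_apply)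

namespace Summit.QuantumFields.BalabanUV.Beta.SymWardLettersUnpacking

noncomputable section

variable {Lc : ℕ}

/-! ## §0 Entries of the sym border tables on the field–multiplier block (sym twins of `BorderLetterPacking` §1) -/

/-- [folklore] The field–multiplier entry of the sym first-order border table `symVhSAt`: `[off z = 0]·m^sym_{(m, blk z)}((β,x), (κ,u))`. -/
theorem symVhSAt_inl_inr' (ρ : Fin 4 → ℤ) (κ : Fin 4) (u x z : Fin 4 → ℤ) (β m : Fin 4) :
    symVhSAt ρ 3 Lc rfl κ u x z (Sum.inl β) (Sum.inr m) = if off Lc z = 0 then symVhKerAt ρ Lc m (blk Lc z) (β, x) (κ, u) else 0 := by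
  unfold symVhSAt
  rw [packVH_inl_inr]

/-- [folklore] The field–multiplier entry of the sym candidate row table `symVh₂SAn1 3 Lc` (root `ctr 4 Lc`): `[off z = 0]·½(s^sym_b(f; g, h) + s^sym_b(f; h, g))`. -/
theorem symVh₂SAn1_inl_inr (κ : Fin 4) (u : Fin 4 → ℤ) (κ' : Fin 4) (u' x z : Fin 4 → ℤ) (β m : Fin 4) :
    symVh₂SAn1 3 Lc κ u κ' u' x z (Sum.inl β) (Sum.inr m) =
      if off Lc z = 0 then (1 / 2 : ℝ) * (symVh2KerAt (ctr 4 Lc) Lc m (blk Lc z) (β, x) (κ, u) (κ', u')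
        + symVh2KerAt (ctr 4 Lc) Lc m (blk Lc z) (β, x) (κ', u') (κ, u)) else 0 := by
  show ((1 / 2 : ℝ) • (symVh₂SAt (ctr 4 Lc) Lc κ u κ' u' + symVh₂SAt (ctr 4 Lc) Lc κ' u' κ u)) x z (Sum.inl β) (Sum.inr m) = _
  rw [Pi.smul_apply, Pi.smul_apply, Pi.smul_apply, Pi.smul_apply, Pi.add_apply, Pi.add_apply, Pi.add_apply, Pi.add_apply, smul_eq_mul]
  unfold symVh₂SAt
  rw [packVH_inl_inr, packVH_inl_inr]
  split_ifs <;> ring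

/-! ## §1 Entries of the gauge-rotation symbol (root `ctr 4 Lc`); `divV_sum_apply` is `WardLettersUnpacking.divV_sum_apply` (opened) -/

/-- [folklore] The gauge-rotation symbol (sum of leg indicators) on a field leg: `Σ_v [x = y_v]`. -/
theorem legSum_inl (s : Finset (Fin (3 + 1) → ℕ)) (Y : Fin (3 + 1) → ℤ) (x : Fin (3 + 1) → ℤ) (β : Fin (3 + 1)) :
    (∑ v ∈ s, legInd (ctr 4 Lc) ((Lc : ℤ) • Y + toSite v)) x (Sum.inl β) =
      ∑ v ∈ s, (if x = (Lc : ℤ) • Y + toSite v then (1 : ℝ) else 0) := by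
  simp only [Finset.sum_apply, legInd_inl]

/-- [folklore] The gauge-rotation symbol on a multiplier leg: `Σ_v [z + ρ_c = y_v]`. -/
theorem legSum_inr (s : Finset (Fin (3 + 1) → ℕ)) (Y : Fin (3 + 1) → ℤ) (z : Fin (3 + 1) → ℤ) (m : Fin (3 + 1)) :
    (∑ v ∈ s, legInd (ctr 4 Lc) ((Lc : ℤ) • Y + toSite v)) z (Sum.inr m) =
      ∑ v ∈ s, (if z + ctr 4 Lc = (Lc : ℤ) • Y + toSite v then (1 : ℝ) else 0) := by
  simp only [Finset.sum_apply, legInd_inr]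

/-! ## §2 The border Ward letter in the first jet slot -/

/-- [folklore] **`hBord0` (LEVEL 0, REMAINDER 0) OF THE SYM ROW ROOT FROM THE BOND-LEVEL WARD IDENTITY** (`RowD1JointEndSymReflTablesAn1S2`'s binder at `RB 0 := 0`, any weight `cB`; `hW` = an1's `SymBorderWardSiteLaw.symBondWardB` at lockB).  HYPOTHESIS `hW` (field–multiplier
entries; `Ssym` written out): for all `Y κ′ u′ x z β m` with `off Lc z = 0`,
`(stepScale 3 Lc 0 · Lc⁴)⁻¹ · Σ_v Σ_κ (cB·½(s(f;(κ,y_v−e_κ),h) + s(f;h,(κ,y_v−e_κ))) − cB·½(s(f;(κ,y_v),h) + s(f;h,(κ,y_v))))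
   = cVH·m_b(f,h)·(½Σ_v[z + ρ_c = y_v]) − (½Σ_v[x = y_v])·cVH·m_b(f,h)`. -/
theorem hBord0_of_bondWard (cB : ℝ)
    (hW : ∀ (Y : Fin 4 → ℤ) (κ' : Fin 4) (u' x z : Fin 4 → ℤ) (β m : Fin 4), off Lc z = 0 →
      (stepScale 3 Lc 0 * (Lc : ℝ) ^ (3 + 1))⁻¹ *
          ∑ v ∈ box (3 + 1) Lc, ∑ κ : Fin (3 + 1),
            (cB * ((1 / 2 : ℝ) * (symVh2KerAt (ctr 4 Lc) Lc m (blk Lc z) (β, x) (κ, (Lc : ℤ) • Y + toSite v - unitVec κ) (κ', u')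
                + symVh2KerAt (ctr 4 Lc) Lc m (blk Lc z) (β, x) (κ', u') (κ, (Lc : ℤ) • Y + toSite v - unitVec κ)))
              - cB * ((1 / 2 : ℝ) * (symVh2KerAt (ctr 4 Lc) Lc m (blk Lc z) (β, x) (κ, (Lc : ℤ) • Y + toSite v) (κ', u')
                + symVh2KerAt (ctr 4 Lc) Lc m (blk Lc z) (β, x) (κ', u') (κ, (Lc : ℤ) • Y + toSite v)))) =
        (-((Lc : ℝ) ^ (3 + 1) * (1 / 2) * (Lc : ℝ) ^ (3 + 1))) * symVhKerAt (ctr 4 Lc) Lc m (blk Lc z) (β, x) (κ', u')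
            * ((1 / 2 : ℝ) * ∑ v ∈ box (3 + 1) Lc, (if z + ctr 4 Lc = (Lc : ℤ) • Y + toSite v then (1 : ℝ) else 0))
          - ((1 / 2 : ℝ) * ∑ v ∈ box (3 + 1) Lc, (if x = (Lc : ℤ) • Y + toSite v then (1 : ℝ) else 0))
            * ((-((Lc : ℝ) ^ (3 + 1) * (1 / 2) * (Lc : ℝ) ^ (3 + 1))) * symVhKerAt (ctr 4 Lc) Lc m (blk Lc z) (β, x) (κ', u'))) :
    ∀ (Y : Fin (3 + 1) → ℤ) (κ' : Fin (3 + 1)) (u' : Fin (3 + 1) → ℤ),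
      (stepScale 3 Lc 0 * (Lc : ℝ) ^ (3 + 1))⁻¹ • ∑ v ∈ box (3 + 1) Lc, divV (fun κ u => cB • symVh₂SAn1 3 Lc κ u κ' u') ((Lc : ℤ) • Y + toSite v) =
        comp ((-((Lc : ℝ) ^ (3 + 1) * (1 / 2) * (Lc : ℝ) ^ (3 + 1))) • symVhSAt (ctr 4 Lc) 3 Lc rfl κ' u')
            (diagK (((1 : ℝ) / 2) • ∑ v ∈ box (3 + 1) Lc, legInd (ctr 4 Lc) ((Lc : ℤ) • Y + toSite v)))
          - comp (diagK (((1 : ℝ) / 2) • ∑ v ∈ box (3 + 1) Lc, legInd (ctr 4 Lc) ((Lc : ℤ) • Y + toSite v)))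
            ((-((Lc : ℝ) ^ (3 + 1) * (1 / 2) * (Lc : ℝ) ^ (3 + 1))) • symVhSAt (ctr 4 Lc) 3 Lc rfl κ' u') := by
  intro Y κ' u'
  funext x z a b
  rw [Pi.smul_apply, Pi.smul_apply, Pi.smul_apply, Pi.smul_apply, smul_eq_mul, divV_sum_apply, Pi.sub_apply, Pi.sub_apply, Pi.sub_apply,
    Pi.sub_apply, comp_diagK_right, comp_diagK_left, Pi.smul_apply, Pi.smul_apply, Pi.smul_apply, Pi.smul_apply, smul_eq_mul]
  rcases a with β | m₀ <;> rcases b with β' | m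
  · -- (inl, inl): everything vanishes
    simp only [Pi.smul_apply, smul_eq_mul, symVh₂SAn1_inl_inl, mul_zero, sub_self, Finset.sum_const_zero]
    unfold symVhSAt; rw [packVH_inl_inl]; ring
  · -- (inl β, inr m): the displayed identity
    simp only [Pi.smul_apply, smul_eq_mul, symVh₂SAn1_inl_inr, symVhSAt_inl_inr']
    rw [legSum_inl, legSum_inr]
    by_cases hz : off Lc z = 0
    · simp only [hz, if_true]
      exact hW Y κ' u' x z β m hz
    · simp only [hz, if_false, mul_zero, sub_self, Finset.sum_const_zero, zero_mul]
  · -- (inr m₀, inl β'): the anti-twin ∕ twin mirror of the displayed identity at (z, x)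
    simp only [Pi.smul_apply, smul_eq_mul, symVh₂SAn1_antiTwin, symVh₂SAn1_inl_inr]
    rw [symVhSAt_symm, symVhSAt_inl_inr', legSum_inl, legSum_inr]
    by_cases hx : off Lc x = 0
    · simp only [hx, if_true]
      have h := hW Y κ' u' z x β' m₀ hx
      simp only [Finset.sum_sub_distrib, Finset.sum_add_distrib, Finset.sum_neg_distrib, ← Finset.mul_sum, mul_add, mul_neg,
        neg_add] at h ⊢
      linear_combination -h
    · simp only [hx, if_false, mul_zero, neg_zero, sub_self, Finset.sum_const_zero, zero_mul]
  · -- (inr, inr): everything vanishes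
    simp only [Pi.smul_apply, smul_eq_mul, symVh₂SAn1_inr_inr, mul_zero, sub_self, Finset.sum_const_zero]
    unfold symVhSAt; rw [packVH_inr_inr]; ring

/-! ## §3 The border Ward letter in the second jet slot -/

/-- [folklore] **`hBord0''` (LEVEL 0, REMAINDER 0) FROM THE SAME BOND-LEVEL WARD IDENTITY**: the sym row table is symmetric in its two jet bonds (`symVh₂SAn1_swap`), so the
second-slot letter is the first-slot letter with the bonds renamed. -/
theorem hBord0''_of_bondWard (cB : ℝ)
    (hW : ∀ (Y : Fin 4 → ℤ) (κ' : Fin 4) (u' x z : Fin 4 → ℤ) (β m : Fin 4), off Lc z = 0 →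
      (stepScale 3 Lc 0 * (Lc : ℝ) ^ (3 + 1))⁻¹ *
          ∑ v ∈ box (3 + 1) Lc, ∑ κ : Fin (3 + 1),
            (cB * ((1 / 2 : ℝ) * (symVh2KerAt (ctr 4 Lc) Lc m (blk Lc z) (β, x) (κ, (Lc : ℤ) • Y + toSite v - unitVec κ) (κ', u')
                + symVh2KerAt (ctr 4 Lc) Lc m (blk Lc z) (β, x) (κ', u') (κ, (Lc : ℤ) • Y + toSite v - unitVec κ)))
              - cB * ((1 / 2 : ℝ) * (symVh2KerAt (ctr 4 Lc) Lc m (blk Lc z) (β, x) (κ, (Lc : ℤ) • Y + toSite v) (κ', u')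
                + symVh2KerAt (ctr 4 Lc) Lc m (blk Lc z) (β, x) (κ', u') (κ, (Lc : ℤ) • Y + toSite v)))) =
        (-((Lc : ℝ) ^ (3 + 1) * (1 / 2) * (Lc : ℝ) ^ (3 + 1))) * symVhKerAt (ctr 4 Lc) Lc m (blk Lc z) (β, x) (κ', u')
            * ((1 / 2 : ℝ) * ∑ v ∈ box (3 + 1) Lc, (if z + ctr 4 Lc = (Lc : ℤ) • Y + toSite v then (1 : ℝ) else 0))
          - ((1 / 2 : ℝ) * ∑ v ∈ box (3 + 1) Lc, (if x = (Lc : ℤ) • Y + toSite v then (1 : ℝ) else 0))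
            * ((-((Lc : ℝ) ^ (3 + 1) * (1 / 2) * (Lc : ℝ) ^ (3 + 1))) * symVhKerAt (ctr 4 Lc) Lc m (blk Lc z) (β, x) (κ', u'))) :
    ∀ (Y : Fin (3 + 1) → ℤ) (κ : Fin (3 + 1)) (u : Fin (3 + 1) → ℤ),
      (stepScale 3 Lc 0 * (Lc : ℝ) ^ (3 + 1))⁻¹ • ∑ v ∈ box (3 + 1) Lc, divV (fun κ' u' => cB • symVh₂SAn1 3 Lc κ u κ' u') ((Lc : ℤ) • Y + toSite v) =
        comp ((-((Lc : ℝ) ^ (3 + 1) * (1 / 2) * (Lc : ℝ) ^ (3 + 1))) • symVhSAt (ctr 4 Lc) 3 Lc rfl κ u)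
            (diagK (((1 : ℝ) / 2) • ∑ v ∈ box (3 + 1) Lc, legInd (ctr 4 Lc) ((Lc : ℤ) • Y + toSite v)))
          - comp (diagK (((1 : ℝ) / 2) • ∑ v ∈ box (3 + 1) Lc, legInd (ctr 4 Lc) ((Lc : ℤ) • Y + toSite v)))
            ((-((Lc : ℝ) ^ (3 + 1) * (1 / 2) * (Lc : ℝ) ^ (3 + 1))) • symVhSAt (ctr 4 Lc) 3 Lc rfl κ u) := by
  intro Y κ u
  have e : (fun κ' u' => cB • symVh₂SAn1 3 Lc κ u κ' u') = fun κ' u' => cB • symVh₂SAn1 3 Lc κ' u' κ u := by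
    funext κ' u'; rw [symVh₂SAn1_swap]
  rw [e]
  exact hBord0_of_bondWard cB hW Y κ u

/-! ## §4 The mixed Ward letter -/

/-- [folklore] **`hM₂` AT `j = 0` OF THE SYM ROW ROOT FROM THE BOND-LEVEL MIXED WARD IDENTITY** (weights `wM2 3 Lc 0 = wM1 3 Lc 0 = 1` kept as
tokens; `M := M1Of 3 Lc (symHessFFAt (ctr 4 Lc) Lc) cΛ`).  HYPOTHESES: `hWm` — the field–field scalar identity with the residual's ff entries; `hR₁ hR₂ hR₃` — the residual `RW₀` has no
other blocks (both sides of the letter are field–field supported). -/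
theorem hM₂0_of_bondWard (cΛ : ℝ) (RW₀ : (Fin (3 + 1) → ℤ) → Fin (3 + 1) → (Fin (3 + 1) → ℤ) → MKer (3 + 1) (Fib 3))
    (hWm : ∀ (y : Fin 4 → ℤ) (ρ' : Fin 4) (w x z : Fin 4 → ℤ) (β β' : Fin 4),
      (stepScale 3 Lc 0 * (Lc : ℝ) ^ (3 + 1))⁻¹ *
          ∑ v ∈ box (3 + 1) Lc, ∑ κ : Fin (3 + 1),
            (wM2 3 Lc 0 * symMixKerAt (ctr 4 Lc) Lc ρ' w (κ, (Lc : ℤ) • y + toSite v - unitVec κ) (β, x) (β', z)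
              - wM2 3 Lc 0 * symMixKerAt (ctr 4 Lc) Lc ρ' w (κ, (Lc : ℤ) • y + toSite v) (β, x) (β', z)) =
        (cΛ * wM1 3 Lc 0) * symHessKerAt (ctr 4 Lc) Lc ρ' w (β, x) (β', z)
            * ((1 / 2 : ℝ) * ∑ v ∈ box (3 + 1) Lc, (if z = (Lc : ℤ) • y + toSite v then (1 : ℝ) else 0))
          - ((1 / 2 : ℝ) * ∑ v ∈ box (3 + 1) Lc, (if x = (Lc : ℤ) • y + toSite v then (1 : ℝ) else 0))
            * ((cΛ * wM1 3 Lc 0) * symHessKerAt (ctr 4 Lc) Lc ρ' w (β, x) (β', z))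
          + RW₀ y ρ' w x z (Sum.inl β) (Sum.inl β'))
    (hR₁ : ∀ y ρ' w x z (β m : Fin 4), RW₀ y ρ' w x z (Sum.inl β) (Sum.inr m) = 0)
    (hR₂ : ∀ y ρ' w x z (m β : Fin 4), RW₀ y ρ' w x z (Sum.inr m) (Sum.inl β) = 0)
    (hR₃ : ∀ y ρ' w x z (m m' : Fin 4), RW₀ y ρ' w x z (Sum.inr m) (Sum.inr m') = 0) :
    ∀ (y : Fin (3 + 1) → ℤ) (ρ' : Fin (3 + 1)) (w : Fin (3 + 1) → ℤ),
      (stepScale 3 Lc 0 * (Lc : ℝ) ^ (3 + 1))⁻¹ • ∑ v ∈ box (3 + 1) Lc,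
          divV (fun κ u => M2Of 3 Lc (symMixFFAt (ctr 4 Lc) Lc) 0 κ u ρ' w) ((Lc : ℤ) • y + toSite v) =
        comp (M1Of 3 Lc (symHessFFAt (ctr 4 Lc) Lc) cΛ 0 ρ' w) (diagK (((1 : ℝ) / 2) • ∑ v ∈ box (3 + 1) Lc, legInd (ctr 4 Lc) ((Lc : ℤ) • y + toSite v)))
          - comp (diagK (((1 : ℝ) / 2) • ∑ v ∈ box (3 + 1) Lc, legInd (ctr 4 Lc) ((Lc : ℤ) • y + toSite v))) (M1Of 3 Lc (symHessFFAt (ctr 4 Lc) Lc) cΛ 0 ρ' w)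
          + RW₀ y ρ' w := by
  intro y ρ' w
  funext x z a b
  rw [Pi.smul_apply, Pi.smul_apply, Pi.smul_apply, Pi.smul_apply, smul_eq_mul, divV_sum_apply, Pi.add_apply, Pi.add_apply, Pi.add_apply,
    Pi.add_apply, Pi.sub_apply, Pi.sub_apply, Pi.sub_apply, Pi.sub_apply, comp_diagK_right, comp_diagK_left]
  simp only [M2Of, M1Of, Pi.smul_apply, smul_eq_mul]
  rcases a with β | m <;> rcases b with β' | m'
  · rw [legSum_inl, legSum_inl]
    simp only [symMixFFAt_inl_inl, symHessFFAt_inl_inl]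
    exact hWm y ρ' w x z β β'
  · simp only [symMixFFAt_inl_inr, symHessFFAt_inl_inr, hR₁, mul_zero, zero_mul, sub_self, add_zero, Finset.sum_const_zero]
  · simp only [symMixFFAt_inr, symHessFFAt_inr, hR₂, mul_zero, zero_mul, sub_self, add_zero, Finset.sum_const_zero]
  · simp only [symMixFFAt_inr, symHessFFAt_inr, hR₃, mul_zero, zero_mul, sub_self, add_zero, Finset.sum_const_zero]

end

end Summit.QuantumFields.BalabanUV.Beta.SymWardLettersUnpacking
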